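import Literature.AlgebraicGeometry.Frobenioids.ArchimedeanPerfectionBiratSection
import Literature.AlgebraicGeometry.Frobenioids.Thm36SubPerfectionUnitsQ
import Literature.AlgebraicGeometry.Frobenioids.PerfectionCoAngularPreSteps
import HarnessLib

/-!
# Frobenioids II, Thm. 3.6 (i) at `Λ = ℚ`, piece P2 (iii): the germs of the NORM-ONE scalars are the units
# `O^×((A, n)) ⊆ O^×((A, n)^birat)` of `C^ℚ = C^pf`

Mochizuki, *The geometry of Frobenioids II: poly-Frobenioids*, Kyushu J. Math. **62** (2008) 401–460, §3,
Thm. 3.6 (i) p. 36 ("rational function monoid naturally isomorphic to `(Φ^fld)^Λ`", `Φ^fld = Φ^gp × Φ^∡`,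
`Φ^∡(Spec K) = O_K^×`) and Thm. 3.6 (v) p. 37 ("`O^×(A)` … [is] isomorphic to `S¹ ⊗_ℤ ℚ` if and only if `Λ = ℚ` and
`A` is complex") [cite: MochizukiFrdII2008, Thm 3.6 (i) p.36]; [FrdI] Prop. 4.4 (ii)/(iii) p. 83 (the injection
`O^×(A) ↪ O^×(A^birat)` and "whose kernel is the image of `O^×(A)`") [cite: MochizukiFrdI2008, Prop. 4.4 (ii) p.83].

abc-iut cell, layer L1, row M13-c3 piece **P2** (seat abc-iut-w5-d246), file 3 of the P2 chain.  For `X = (A, n)`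
in THE perfection of the archimedean Frobenioid `C` and a naively isotropic Frobenius level `c` of `A`:
* `germ_eq_unitsToBirat` — for `A^{(c)}` complex and `|w| = 1`, the standard germ of scalar `w` (file 2,
  `germ`) IS the image under [FrdI] Prop. 4.4 (ii)'s `O^×(X) → O^×(X^birat)` (abc-iut-L1-t10's
  `BiratUnits.unitsToBirat`) of the class (abc-iut-w4-d074's `Thm36Sub.classAut`) of the rotation by `w` of
  `A^{(c)}` (abc-iut-L1's `unitAutOver`);
* `exists_pow_eq_one_of_germ_eq_one` — a norm-one scalar with trivial germ is a root of unity (w4-d074's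
  `classAut_eq_one_iff`: trivial class ⟺ some power of the normalised scalar is `1`); for `A^{(c)}` real the
  norm-one scalars are `±1` (`sq_eq_one_of_mem_scalars_real`);
* `exists_germ_eq_unitsToBirat` — for `A` complex EVERY unit of `X` is such a rotation germ at the fixed level `c`
  (w4-d074's value map `unitVal : O^×(X) → S¹ ⊗_ℤ ℚ`, Thm. 3.6 (v): values `y ⊗ 1/c` exhaust `S¹ ⊗ ℚ` because `S¹`
  is divisible); for `A` real `O^×(X)` is trivial (w4-d074's `unitsSubgroup_eq_bot_of_isReal`).
Proof-only; nothing here bears on [IUTchIII] Cor. 3.12.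
-/

noncomputable section

namespace Literature.AlgebraicGeometry.Frobenioids

open CategoryTheory Opposite
open scoped TensorProduct NNReal

universe v u

namespace ArchFrd

namespace Thm36Sub

variable {D : Type u} [Category.{v} D] {π : D ⥤ D0}

/-! ### Norm-one scalars of a real base are `±1` -/

/-- A real scalar of norm `1` squares to `1` (`O_ℝ^× = {±1}`, Def. 3.1 (ii) p. 23).
[cite: MochizukiFrdII2008, Def 3.1 (ii) p.23] -/
theorem sq_eq_one_of_mem_scalars_real {w : ℂˣ} (hw : w ∈ D0.scalars D0.real) (h1 : ‖(w : ℂ)‖ = 1) :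
    w ^ 2 = 1 := by
  obtain ⟨r, rfl⟩ := hw
  apply Units.ext
  have hr : ‖((r : ℝˣ) : ℝ)‖ = 1 := by
    have := h1
    change ‖((r : ℝ) : ℂ)‖ = 1 at this
    rwa [Complex.norm_real] at this
  rw [Units.val_pow_eq_pow_val, Units.val_one]
  change (((r : ℝ) : ℂ)) ^ 2 = 1
  rw [← Complex.ofReal_pow, ← sq_abs, ← Real.norm_eq_abs, hr, one_pow, Complex.ofReal_one]

section Link

open PreFrobenioid PreFrobenioid.Perfection

variable {hF : PreFrobenioid.IsFrobenioid (C.toElem π)} (X : pfCat π hF)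
  (hPf : PreFrobenioid.IsFrobenioid (pfStr π hF)) {c : ℕ+} (hc : (frobPow hF X.obj c).fst.IsNaivelyIsotropic)

/-- The scalar arrow with scalar `1` followed by the rotation by `w` is the scalar arrow with scalar `w`.
[cite: MochizukiFrdII2008, Ex 3.3 (i) p.27] -/
theorem discIncl_comp_unitAutOver (hcx : (frobPow hF X.obj c).fst.IsComplexObj) (t : PosReal)
    (ht : (t : ℝ) ≤ (frobPow hF X.obj c).fst.tip) (w : ℂˣ) (hw : ‖(w : ℂ)‖ = 1)
    (hwK : w ∈ D0.scalars (frobPow hF X.obj c).fst.base) (h : ‖(w : ℂ)‖ * t ≤ (frobPow hF X.obj c).fst.tip) :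
    discIncl (frobPow hF X.obj c) hc t 1 (one_mem _) (norm_one_mul_le ht) ≫
        (unitAutOver π (frobPow hF X.obj c) hc hcx w hw).hom =
      discIncl (frobPow hF X.obj c) hc t w hwK h := by
  refine CFP.hom_ext (C0.hom_ext ?_ ?_ ?_) ?_
  · exact Category.comp_id _
  · rfl
  · change (𝟙 (frobPow hF X.obj c).fst.base : _ ⟶ _).act w * 1 ^ ((1 : ℕ+) : ℕ) = w
    rw [PNat.one_coe, pow_one, mul_one, D0.Hom.act, D0.twists_id, D0.galAct_false]
  · exact Category.comp_id _

/-- The class in `O^×(X)` of the rotation of `A^{(c)}` by a norm-one scalar `w` (abc-iut-w4-d074's `classAut` of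
abc-iut-L1's `unitAutOver`), as an element of the units subgroup. [cite: MochizukiFrdII2008, Thm 3.6 (v) p.37] -/
def rotUnit (hcx : (frobPow hF X.obj c).fst.IsComplexObj) (w : ℂˣ) (hw : ‖(w : ℂ)‖ = 1) :
    unitsSubgroup (pfStr π hF) X :=
  ⟨classAut X c (unitAutOver π (frobPow hF X.obj c) hc hcx w hw),
    classAut_mem X c _ (unitAutOver_mem π (frobPow hF X.obj c) hc hcx w hw)⟩

/-- **The germ of a norm-one scalar is a unit**: `germ w = unitsToBirat [rotation by w]` ([FrdI] Prop. 4.4 (ii):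
`u ↦ (id, u)`; here `(ι₁, ι_w) ∼ (id, [rot_w])` along the co-angular pre-step `ι₁`).
[cite: MochizukiFrdI2008, Prop. 4.4 (ii) p.83] -/
theorem germ_eq_unitsToBirat (hcx : (frobPow hF X.obj c).fst.IsComplexObj) (w : ℂˣ) (hw : ‖(w : ℂ)‖ = 1)
    (hwK : w ∈ D0.scalars (frobPow hF X.obj c).fst.base) :
    germ X hPf hc w hwK = BiratUnits.unitsToBirat hPf X (rotUnit X hc hcx w hw) := by
  have ht := rad_le (frobPow hF X.obj c) w
  have h := norm_mul_rad_le (frobPow hF X.obj c) w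
  symm
  refine BiratUnits.sound ⟨discPf X c (rad (frobPow hF X.obj c) w),
    (stdFrac X c hc (rad (frobPow hF X.obj c) w) ht w hwK h).den, 𝟙 _,
    (stdFrac X c hc (rad (frobPow hF X.obj c) w) ht w hwK h).den_mem, isCoAngularPreStep_id hPf _, ?_, ?_⟩
  · change inclHom X c _ _ ≫ 𝟙 X = 𝟙 _ ≫ inclHom X c _ _
    rw [Category.comp_id, Category.id_comp]
  · change inclHom X c _ _ ≫ endClass X c (unitAutOver π (frobPow hF X.obj c) hc hcx w hw).hom =
      𝟙 _ ≫ inclHom X c _ _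
    rw [Category.id_comp, inclHom, inclHom, inclRep, inclRep, mk_comp_endClass, Category.assoc,
      discIncl_comp_unitAutOver X hc hcx _ ht w hw hwK h]

/-- The normalised scalar (abc-iut-w4-d074) of the rotation by `w` is the Galois twist of `w`.
[cite: MochizukiFrdII2008, Thm 3.6 (v) p.37] -/
theorem normScalar_unitAutOver (hcx : (frobPow hF X.obj c).fst.IsComplexObj) (w : ℂˣ) (hw : ‖(w : ℂ)‖ = 1) :
    normScalar X c (unitAutOver π (frobPow hF X.obj c) hc hcx w hw) = D0.galAct (levelTwist X c) w := rfl

/-- **A norm-one scalar with trivial germ is a root of unity** (complex base): `germ w = 1` forces the class of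
the rotation by `w` to be trivial, i.e. (w4-d074's `classAut_eq_one_iff`) some power of its normalised scalar —
the Galois twist of `w` — is `1`. [cite: MochizukiFrdII2008, Thm 3.6 (v) p.37] -/
theorem exists_pow_eq_one_of_germ_eq_one (hcx : (frobPow hF X.obj c).fst.IsComplexObj) (w : ℂˣ)
    (hw : ‖(w : ℂ)‖ = 1) (hwK : w ∈ D0.scalars (frobPow hF X.obj c).fst.base) (h1 : germ X hPf hc w hwK = 1) :
    ∃ N : ℕ+, w ^ (N : ℕ) = 1 := by
  rw [germ_eq_unitsToBirat X hPf hc hcx w hw hwK, ← map_one (BiratUnits.unitsToBirat hPf X)] at h1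
  have h2 : classAut X c (unitAutOver π (frobPow hF X.obj c) hc hcx w hw) = 1 :=
    congrArg Subtype.val (BiratUnits.unitsToBirat_injective h1)
  obtain ⟨k, hk⟩ := (classAut_eq_one_iff X c _ (unitAutOver_mem π (frobPow hF X.obj c) hc hcx w hw)).mp h2
  refine ⟨k, ?_⟩
  rw [normScalar_unitAutOver, ← map_pow] at hk
  have := congrArg (D0.galAct (levelTwist X c)) hk
  rwa [D0.galAct_galAct, map_one] at this

/-- The value (w4-d074's `unitVal`) of the rotation unit by `w`: `[twist(w)] ⊗ (1/c)`.
[cite: MochizukiFrdII2008, Thm 3.6 (v) p.37] -/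
theorem unitVal_rotUnit (hcx : (frobPow hF X.obj c).fst.IsComplexObj) (w : ℂˣ) (hw : ‖(w : ℂ)‖ = 1) :
    unitVal X (rotUnit X hc hcx w hw) =
      Additive.ofMul (unitCirc (D0.galAct (levelTwist X c) w)) ⊗ₜ[ℤ] ((c : ℚ)⁻¹) := by
  rw [unitVal_eq X (rotUnit X hc hcx w hw) (unitAutOver π (frobPow hF X.obj c) hc hcx w hw)
    (unitAutOver_mem π (frobPow hF X.obj c) hc hcx w hw) rfl]
  unfold levelVal
  rw [normScalar_unitAutOver]

/-- **Every unit of `X = (A, n)`, `A` complex, is a rotation germ at the level `c`** (surjectivity of the germs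
of norm-one scalars onto `O^×(X)`; Thm. 3.6 (v): `O^×(X) ≅ S¹ ⊗_ℤ ℚ` through `unitVal`, and the values
`y ⊗ 1/c`, `y ∈ S¹`, exhaust `S¹ ⊗ ℚ` since `S¹` is divisible). [cite: MochizukiFrdII2008, Thm 3.6 (v) p.37] -/
theorem exists_germ_eq_unitsToBirat (hcx : (frobPow hF X.obj c).fst.IsComplexObj)
    (u : unitsSubgroup (pfStr π hF) X) :
    ∃ (w : ℂˣ) (hwK : w ∈ D0.scalars (frobPow hF X.obj c).fst.base),
      ‖(w : ℂ)‖ = 1 ∧ BiratUnits.unitsToBirat hPf X u = germ X hPf hc w hwK := by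
  -- a representative of `u` at some level `c₀` and its normalised scalar `z`
  obtain ⟨c₀, θ₀, hθ₀, e₀⟩ := exists_unit_rep X u.1 u.2
  have hu : classAut X c₀ θ₀ = u.1 := Iso.ext e₀
  have hz : ‖(normScalar X c₀ θ₀ : ℂ)‖ = 1 := norm_normScalar X c₀ θ₀ hθ₀
  -- a `c₀`-th root `v` of `z ^ c` on the unit circle, twisted back to the scalar `w`
  obtain ⟨v, hv⟩ := normOne_exists_pow_eq
    (⟨normScalar X c₀ θ₀, (mem_normOneSubgroup_iff ℂ _).mpr hz⟩ ^ (c : ℕ)) c₀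
  have hv1 : ‖((v : ℂˣ) : ℂ)‖ = 1 := (mem_normOneSubgroup_iff ℂ _).mp v.2
  set w : ℂˣ := D0.galAct (levelTwist X c) (v : ℂˣ) with hwdef
  have hw : ‖(w : ℂ)‖ = 1 := by rw [hwdef, D0.norm_galAct]; exact hv1
  have hwK : w ∈ D0.scalars (frobPow hF X.obj c).fst.base := by
    rw [show (frobPow hF X.obj c).fst.base = D0.complex from hcx, D0.scalars_complex]; exact Subgroup.mem_top w
  refine ⟨w, hwK, hw, ?_⟩
  rw [germ_eq_unitsToBirat X hPf hc hcx w hw hwK]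
  congr 1
  -- `unitVal` separates units: compare the values of `u` and of the rotation unit
  have hval : unitVal X (rotUnit X hc hcx w hw) = unitVal X u := by
    rw [unitVal_rotUnit, unitVal_eq X u θ₀ hθ₀ hu]
    unfold levelVal
    rw [hwdef, D0.galAct_galAct, tmul_inv_eq_smul_tmul_inv _ c c₀, tmul_inv_eq_smul_tmul_inv _ c₀ c, mul_comm c₀ c]
    congr 1
    rw [natCast_zsmul, natCast_zsmul, ← ofMul_pow, ← ofMul_pow, ← unitCirc_pow hv1, ← unitCirc_pow hz]
    congr 1
    have h' : ((v : ℂˣ)) ^ ((c₀ : ℕ+) : ℕ) = normScalar X c₀ θ₀ ^ (c : ℕ) := by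
      have := congrArg (fun x : normOneSubgroup ℂ => (x : ℂˣ)) hv
      simpa only [SubmonoidClass.coe_pow] using this
    rw [h']
  have hq : unitVal X ((rotUnit X hc hcx w hw)⁻¹ * u) = 0 := by
    have e := unitVal_mul X (rotUnit X hc hcx w hw) ((rotUnit X hc hcx w hw)⁻¹ * u)
    rw [mul_inv_cancel_left, ← hval] at e
    exact left_eq_add.mp e
  have := eq_one_of_unitVal_eq_zero X _ hq
  rw [inv_mul_eq_one] at this
  exact this.symm

end Link

end Thm36Sub

end ArchFrd

end Literature.AlgebraicGeometry.Frobenioids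

end
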